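import Mathlib
import Literature.AlgebraicGeometry.Resolution.CobordantTupleGame
import Literature.AlgebraicGeometry.Resolution.CobordantChartCoefficients
import Literature.AlgebraicGeometry.Resolution.FormalCoordinateChange
import Summits.ResolutionOfSingularities.ResolutionOfSingularities.Theorems.WeightedInvariantLocalWeightedDropMonomialPhaseChart

/-!
# `LocalWeightedDrop`, line `nc-game-transport`, rung R2 (hyperplane arrangements): LINEAR FORMS in `k⟦x₀,…,x_m⟧` under linear
# substitutions, the cobordant chart with weights `≤ 1`, and the slice

[OURS · L1 W4.3 · chain w43, engine crux `LocalWeightedDrop` stmt-ResolutionOfSingularities-8899; strategist res-L1-w43-strat-1's line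
`nc-game-transport`, TOT rung R2 «hyperplane arrangements» (spec `L/res-L1-w43-strat-1/TOT-RUNGS-SPEC.md` §R2); res-type-088.]  The
power-series algebra of the arrangement game (`…NCArrangements`); nothing here is a statement of any manuscript.

* `linForm a = Σ aᵢ • xᵢ` (coefficient vector `a : Fin (m+1) → k`), `linFormUp a = Σ aᵢ • y′ᵢ` (the same form read in the chart variables
  `y′ᵢ = X i.succ`, no `s = X 0`), `restr l a` (the coefficient vector of `linFormUp a` sliced at `y′_l = 0`, re-indexed: slot `0` — the
  `s`-slot — gets `0`, slot `q.succ` gets `a (l.succAbove q)`), `restrLin l` (the same as a linear map).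
* `subst_linSubst_linForm` — under the linear substitution `xᵢ ↦ Σⱼ Mᵢⱼ xⱼ` a form transforms by `a ↦ a ᵥ* M`; `linMat_linSubst`,
  `constantCoeff_linSubst` (legality data of `linSubst M`).
* `subst_chart_linForm_on` / `_off` — under `chart_{w,c}` with `w = 𝟙_S`, `c` supported on `S`: a form supported ON `S` becomes
  `s · (C (a ⬝ᵥ c) + linFormUp a)`, a form supported OFF `S` is untouched (`linFormUp a`).
* `not_X_dvd_C_add_linFormUp`, `constantCoeff_C_add_linFormUp` — the bracket factors are `s`-free; `slice_C_add_linFormUp` — their slices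
  at a live slot `l` are `C r + linForm (restr l a)`.
-/

set_option linter.dupNamespace false -- mandated namespace of this single-conjunct summit

namespace Summit.ResolutionOfSingularities.ResolutionOfSingularities.Theorems

namespace NCArrangement

open MvPowerSeries Matrix Literature.AlgebraicGeometry.Resolution

variable {k : Type} [Field k] {m : ℕ}

/-! ## Linear forms -/

/-- The LINEAR FORM with coefficient vector `a`: `Σᵢ aᵢ • xᵢ ∈ k⟦x₀,…,x_m⟧`. -/
noncomputable def linForm (a : Fin (m + 1) → k) : MvPowerSeries (Fin (m + 1)) k := ∑ i, a i • X i

/-- The same form read in the chart variables `y′ᵢ = X i.succ` of `k⟦s, y′₀, …, y′_m⟧` (no `s`). -/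
noncomputable def linFormUp (a : Fin (m + 1) → k) : MvPowerSeries (Fin (m + 1 + 1)) k := ∑ i, a i • X i.succ

/-- The coefficient vector of `linFormUp a` SLICED at `y′_l = 0` and re-indexed by the slice: slot `0` (the `s`-slot) gets `0`, slot `q.succ`
gets `a (l.succAbove q)`. -/
def restr (l : Fin (m + 1)) (a : Fin (m + 1) → k) : Fin (m + 1) → k :=
  Fin.cases 0 (fun q => a (l.succAbove q))

/-- `restr l` as a linear map. -/
def restrLin (l : Fin (m + 1)) : (Fin (m + 1) → k) →ₗ[k] (Fin (m + 1) → k) where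
  toFun := restr l
  map_add' a b := by
    funext i
    refine Fin.cases ?_ (fun q => ?_) i <;> simp [restr]
  map_smul' r a := by
    funext i
    refine Fin.cases ?_ (fun q => ?_) i <;> simp [restr]

/-- Unfolding `restrLin`. -/
@[simp] theorem restrLin_apply (l : Fin (m + 1)) (a : Fin (m + 1) → k) : restrLin l a = restr l a := rfl

/-- The `s`-slot of a sliced vector is `0`. -/
@[simp] theorem restr_zero (l : Fin (m + 1)) (a : Fin (m + 1) → k) : restr l a 0 = 0 := rfl

/-- The other slots of a sliced vector. -/
@[simp] theorem restr_succ (l : Fin (m + 1)) (a : Fin (m + 1) → k) (q : Fin m) : restr l a q.succ = a (l.succAbove q) := rfl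

/-- If the sliced vector vanishes, the original is supported on the slot `l`. -/
theorem eq_zero_of_restr_eq_zero {l : Fin (m + 1)} {a : Fin (m + 1) → k} (h : restr l a = 0) {i : Fin (m + 1)} (hi : i ≠ l) :
    a i = 0 := by
  obtain ⟨q, rfl⟩ := Fin.exists_succAbove_eq hi
  have := congr_fun h q.succ
  rwa [restr_succ] at this

/-- A vector supported on the slot `l` pairs with `c` as `a l * c l`. -/
theorem dotProduct_eq_of_support_single {l : Fin (m + 1)} {a : Fin (m + 1) → k} (h : ∀ i, i ≠ l → a i = 0) (c : Fin (m + 1) → k) :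
    a ⬝ᵥ c = a l * c l := by
  rw [dotProduct, Finset.sum_eq_single l (fun i _ hi => by rw [h i hi, zero_mul]) (fun hl => absurd (Finset.mem_univ l) hl)]

/-- Coefficients of a linear form. -/
theorem coeff_linForm_single (a : Fin (m + 1) → k) (i : Fin (m + 1)) :
    coeff (Finsupp.single i 1) (linForm a) = a i := by
  classical
  unfold linForm
  rw [map_sum, Finset.sum_eq_single i]
  · rw [coeff_smul, coeff_index_single_X, if_pos rfl, mul_one]
  · intro j _ hji
    rw [coeff_smul, coeff_index_single_X, if_neg (Ne.symm hji), mul_zero]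
  · exact fun h => absurd (Finset.mem_univ i) h

/-- A non-zero coefficient vector gives a non-zero form. -/
theorem linForm_ne_zero {a : Fin (m + 1) → k} (ha : a ≠ 0) : linForm a ≠ 0 := by
  intro h
  apply ha
  funext i
  have := coeff_linForm_single a i
  rw [h, map_zero] at this
  exact this.symm

/-- The form of a standard basis vector is the variable. -/
theorem linForm_single (i : Fin (m + 1)) : linForm (Pi.single i (1 : k)) = X i := by
  unfold linForm
  rw [Finset.sum_eq_single i]
  · rw [Pi.single_eq_same, one_smul]
  · intro j _ hji
    rw [Pi.single_eq_of_ne hji, zero_smul]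
  · exact fun h => absurd (Finset.mem_univ i) h

/-- Coefficients of `C r + linFormUp a` at the chart variables. -/
theorem coeff_C_add_linFormUp_single (r : k) (a : Fin (m + 1) → k) (i : Fin (m + 1)) :
    coeff (Finsupp.single i.succ 1) (C r + linFormUp a) = a i := by
  classical
  unfold linFormUp
  rw [map_add, coeff_C, if_neg (Finsupp.single_ne_zero.mpr one_ne_zero), zero_add, map_sum, Finset.sum_eq_single i]
  · rw [coeff_smul, coeff_index_single_X, if_pos rfl, mul_one]
  · intro j _ hji
    rw [coeff_smul, coeff_index_single_X, if_neg (fun h => hji (Fin.succ_injective _ h).symm), mul_zero]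
  · exact fun h => absurd (Finset.mem_univ i) h

/-- The constant term of `C r + linFormUp a` is `r`. -/
theorem constantCoeff_C_add_linFormUp (r : k) (a : Fin (m + 1) → k) : constantCoeff (C r + linFormUp a) = r := by
  unfold linFormUp
  rw [map_add, constantCoeff_C, map_sum, Finset.sum_eq_zero (fun i _ => by
    rw [smul_eq_C_mul, map_mul, constantCoeff_X, mul_zero]), add_zero]

/-- THE BRACKET FACTORS ARE `s`-FREE: `s ∤ C r + linFormUp a` for `a ≠ 0`. -/
theorem not_X_dvd_C_add_linFormUp (r : k) {a : Fin (m + 1) → k} (ha : a ≠ 0) :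
    ¬ X (0 : Fin (m + 1 + 1)) ∣ C r + linFormUp a := by
  intro h
  apply ha
  funext i
  rw [X_dvd_iff] at h
  have h0 : (Finsupp.single (i.succ : Fin (m + 1 + 1)) 1 : Fin (m + 1 + 1) →₀ ℕ) 0 = 0 := by
    rw [Finsupp.single_apply, if_neg (Fin.succ_ne_zero i)]
  have := h _ h0
  rwa [coeff_C_add_linFormUp_single] at this

/-! ## Linear substitutions -/

/-- Under `xᵢ ↦ Σⱼ Mᵢⱼ xⱼ` a linear form transforms by `a ↦ a ᵥ* M`. -/
theorem subst_linSubst_linForm (M : Matrix (Fin (m + 1)) (Fin (m + 1)) k) (a : Fin (m + 1) → k) :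
    subst (FormalCoordChange.linSubst M) (linForm a) = linForm (a ᵥ* M) := by
  have hM := FormalCoordChange.hasSubst_linSubst M
  unfold linForm
  rw [← coe_substAlgHom hM, map_sum]
  simp_rw [map_smul, coe_substAlgHom, subst_X hM, FormalCoordChange.linSubst, Finset.smul_sum, smul_smul]
  rw [Finset.sum_comm]
  refine Finset.sum_congr rfl fun j _ => ?_
  rw [← Finset.sum_smul]
  rfl

/-- The same for a finite product of linear forms. -/
theorem subst_linSubst_prod_linForm {ι : Type} (M : Matrix (Fin (m + 1)) (Fin (m + 1)) k) (s : Finset ι)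
    (a : ι → Fin (m + 1) → k) :
    subst (FormalCoordChange.linSubst M) (∏ j ∈ s, linForm (a j)) = ∏ j ∈ s, linForm (a j ᵥ* M) := by
  rw [← coe_substAlgHom (FormalCoordChange.hasSubst_linSubst M), map_prod]
  exact Finset.prod_congr rfl fun j _ => by rw [coe_substAlgHom, subst_linSubst_linForm]

/-- The linear part of `linSubst M` is `M`. -/
theorem linMat_linSubst (M : Matrix (Fin (m + 1)) (Fin (m + 1)) k) :
    (Matrix.of fun i j => coeff (Finsupp.single j 1) (FormalCoordChange.linSubst M i)) = M := by
  ext i j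
  rw [Matrix.of_apply]
  have : FormalCoordChange.linSubst M i = linForm (M i) := rfl
  rw [this, coeff_linForm_single]

/-- `linSubst M` has no constant terms. -/
theorem constantCoeff_linSubst (M : Matrix (Fin (m + 1)) (Fin (m + 1)) k) (i : Fin (m + 1)) :
    constantCoeff (FormalCoordChange.linSubst M i) = 0 := by
  unfold FormalCoordChange.linSubst
  rw [map_sum]
  exact Finset.sum_eq_zero fun j _ => by rw [smul_eq_C_mul, map_mul, constantCoeff_X, mul_zero]

/-! ## The chart with weights `𝟙_S` -/

/-- A FORM SUPPORTED ON THE CENTRE'S BLOCK: under `chart_{w,c}` with `wᵢ = 1` wherever `aᵢ ≠ 0` it becomes `s · (C (a ⬝ᵥ c) + linFormUp a)`. -/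
theorem subst_chart_linForm_on {w : Fin (m + 1) → ℕ} {c : Fin (m + 1) → k} (hc : ∀ i, w i = 0 → c i = 0)
    {a : Fin (m + 1) → k} (hw : ∀ i, a i ≠ 0 → w i = 1) :
    subst (CobordantChart.chart w c) (linForm a) = X 0 * (C (a ⬝ᵥ c) + linFormUp a) := by
  have hch := CobordantChart.hasSubst_chart w c hc
  unfold linForm linFormUp
  rw [← coe_substAlgHom hch, map_sum, dotProduct, map_sum, ← Finset.sum_add_distrib, Finset.mul_sum]
  refine Finset.sum_congr rfl fun i _ => ?_
  rw [map_smul, coe_substAlgHom, subst_X hch, CobordantChart.chart_apply]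
  by_cases hai : a i = 0
  · rw [hai, zero_smul, zero_mul, map_zero, zero_smul, add_zero, mul_zero]
  · rw [hw i hai, pow_one, smul_eq_C_mul, smul_eq_C_mul, map_mul]
    ring

/-- A FORM SUPPORTED OFF THE CENTRE'S BLOCK is untouched: `linFormUp a`. -/
theorem subst_chart_linForm_off {w : Fin (m + 1) → ℕ} {c : Fin (m + 1) → k} (hc : ∀ i, w i = 0 → c i = 0)
    {a : Fin (m + 1) → k} (hw : ∀ i, a i ≠ 0 → w i = 0) :
    subst (CobordantChart.chart w c) (linForm a) = linFormUp a := by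
  have hch := CobordantChart.hasSubst_chart w c hc
  unfold linForm linFormUp
  rw [← coe_substAlgHom hch, map_sum]
  refine Finset.sum_congr rfl fun i _ => ?_
  rw [map_smul, coe_substAlgHom, subst_X hch, CobordantChart.chart_apply]
  by_cases hai : a i = 0
  · rw [hai, zero_smul, zero_smul]
  · rw [hw i hai, pow_zero, one_mul, hc i (hw i hai), map_zero, zero_add]

/-! ## The slice at a live slot -/

/-- The slice of `linFormUp a` at `y′_l = 0` is the form of the sliced coefficient vector. -/
theorem slice_linFormUp (l : Fin (m + 1)) (a : Fin (m + 1) → k) :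
    TupleGame.slice l (linFormUp a) = linForm (restr l a) := by
  have hs := CobordantChartPlaneSlice.hasSubst_slice (R := k) l
  unfold linFormUp linForm TupleGame.slice
  rw [← coe_substAlgHom hs, map_sum, Fin.sum_univ_succAbove _ l, Fin.sum_univ_succ]
  simp_rw [map_smul, coe_substAlgHom]
  rw [subst_X hs, if_pos rfl, smul_zero, zero_add, restr_zero, zero_smul, zero_add]
  refine Finset.sum_congr rfl fun q _ => ?_
  rw [subst_X hs, if_neg (fun h => Fin.succAbove_ne l q (Fin.succ_injective _ h)), restr_succ,
    ← Fin.succ_succAbove_succ, CobordantChartPlaneSlice.predAbove_succ_succAbove]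

/-- The slice of a bracket factor. -/
theorem slice_C_add_linFormUp (l : Fin (m + 1)) (r : k) (a : Fin (m + 1) → k) :
    TupleGame.slice l (C r + linFormUp a) = C r + linForm (restr l a) := by
  rw [TupleMonomialPhase.slice_add, TupleMonomialPhase.slice_C, slice_linFormUp]

/-- The slice over a finite product. -/
theorem slice_finset_prod {ι : Type} (l : Fin (m + 1)) (s : Finset ι) (F : ι → MvPowerSeries (Fin (m + 1 + 1)) k) :
    TupleGame.slice l (∏ j ∈ s, F j) = ∏ j ∈ s, TupleGame.slice l (F j) := by
  unfold TupleGame.slice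
  rw [← coe_substAlgHom (CobordantChartPlaneSlice.hasSubst_slice l), map_prod]

end NCArrangement

end Summit.ResolutionOfSingularities.ResolutionOfSingularities.Theorems
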